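import Summits.CriticalPhenomena.Ising3DConformalLimit.Theorems.PerfectScreeningCoulombImpliesNontrivialIsothermOfOneArm
import Summits.CriticalPhenomena.Ising3DConformalLimit.Theorems.AnomalousForcesInteractionEtaPositiveOfIsotherm
import HarnessLib

/-!
# Crux `EtaPositive` (stmt-CriticalPhenomena-2600) closed modulo two THERMAL rates: the extrapolation entrance

Route `AnomalousForcesInteraction` (Ising3DConformalLimit), line `birth`. The line closes the crux from any upper
critical-isotherm bound `m(β_c(3), h) ≤ A h^b` with `b > 1/5` (`EtaPositive_of_isothermGain`). This file makes the
one entrance of the line's entrance map that was recorded "alive in principle" but never formalised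
(`Cruxes/EtaPositive/PROMOTE.md` §3, row "temperature extrapolation") into a third pre-paid certificate: the
critical isotherm is controlled by the LOW-TEMPERATURE side `β = β_c + t`, `h = 0⁺`, through GKS monotonicity in `β`
and the GHS tangent line in the field,

  `m(β_c, h) ≤ m(β_c + t, h) ≤ m*(β_c + t) + (β_c + t) · h · χ⁺(β_c + t)`,

where `χ⁺(β) = Σ_y ⟨σ₀;σ_y⟩⁺_{β,0}` is the plus-state susceptibility (finite for `β > β_c` by
Duminil-Copin–Goswami–Raoufi 2020; here it only enters through finite partial sums, so no summability is assumed).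
Consequently two thermal RATES — an upper bound `m*(β_c + t) ≤ C₁ t^{b̂}` on the vanishing of the spontaneous
magnetisation (continuity `m*(β_c) = 0` is Aizenman–Duminil-Copin–Sidoravicius 2015; no rate is known on `ℤ³`) and an
upper bound `χ⁺(β_c + t) ≤ C₂ t^{-γ'}` — give the isotherm rate `b = b̂/(b̂ + γ')` (`t = h^{1/(b̂+γ')}`), which is
`1/δ` exactly under Widom scaling `β̂δ = β̂ + γ'`; and `b > 1/5 ⟺ 4b̂ > γ'` (numerically `4 · 0.3265 = 1.306 > 1.237`,
margin `0.069`).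

* `magnetizationInField_criticalBeta_le_thermal` — for `t ≥ 0`, `h ≥ 0` and every finite-partial-sum bound
  `Σ_{y∈Λ} ⟨σ₀;σ_y⟩⁺_{β_c+t,0} ≤ X` (all finite `Λ`): `m(β_c, h) ≤ m*(β_c + t) + (β_c + t) X h`;
* `isotherm_of_thermalRates` — the two rates give `m(β_c,h) ≤ A h^{b̂/(b̂+γ')}` on `(0, h₀]`;
* `EtaPositive_of_thermalRates` — registered stub: with `4b̂ > γ'` the crux follows BY NAME.

Both hypotheses are open problems on `ℤ³` of the same calibre as the crux (each is an exponent-rate statement at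
`β_c⁺`); the certificate transports them, it does not create an exponent.
-/

noncomputable section

namespace Summit.CriticalPhenomena.Ising3DConformalLimit.AnomalousForcesInteractionEtaPositive

open Literature.Probability.LatticeModels Literature.Barriers.CriticalPhenomena Filter Set Finset
open scoped Topology BigOperators

/-- **Thermal extrapolation bound for the critical isotherm.** For `t ≥ 0`, `h ≥ 0` and any `X` bounding all finite
partial sums of the plus-state truncated two-point function at `(β_c + t, 0)`,
`Σ_{y ∈ Λ} (⟨σ₀σ_y⟩⁺ - ⟨σ₀⟩⁺⟨σ_y⟩⁺)_{β_c+t, 0} ≤ X`, one has `m(β_c, h) ≤ m*(β_c + t) + (β_c + t) X h`.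
Proof: `m(β_c,h) ≤ m(β_c+t,h)` (GKS, `plusCorr_mono_params`) `≤ ⟨σ₀⟩⁺_{box L; β_c+t, h}` (plus boxes decrease to the
plus state) `≤ ⟨σ₀⟩⁺_{box L; β_c+t, 0} + (β_c+t) h Σ_{y∈box L}⟨σ₀;σ_y⟩⁺_{box L; β_c+t, 0}` (GHS tangent line,
`boxMag_le_zeroField_add_field_mul`) `≤ ⟨σ₀⟩⁺_{box L; β_c+t, 0} + (β_c+t) h X` (GHS volume monotonicity
`isingTrunc_plus_box_le_plusExpect`), and `⟨σ₀⟩⁺_{box L; β, 0} → m*(β)` as `L → ∞`. -/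
theorem magnetizationInField_criticalBeta_le_thermal {t h X : ℝ} (ht : 0 ≤ t) (hh : 0 ≤ h)
    (hX : ∀ Λ : Finset (Site 3), ∑ y ∈ Λ,
      (plusExpect 3 (criticalBeta 3 + t) 0 (fun σ => spinAt 0 σ * spinAt y σ) -
        plusExpect 3 (criticalBeta 3 + t) 0 (spinAt 0) * plusExpect 3 (criticalBeta 3 + t) 0 (spinAt y)) ≤ X) :
    magnetizationInField 3 (criticalBeta 3) h ≤
      spontaneousMagnetization 3 (criticalBeta 3 + t) + (criticalBeta 3 + t) * X * h := by
  set β : ℝ := criticalBeta 3 + t with hβdef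
  have hβc : 0 ≤ criticalBeta 3 := criticalBeta_nonneg 3
  have hβ : 0 ≤ β := by rw [hβdef]; linarith
  -- GKS monotonicity in `β`
  have h1 : magnetizationInField 3 (criticalBeta 3) h ≤ magnetizationInField 3 β h := by
    rw [magnetizationInField_eq_plusCorr, magnetizationInField_eq_plusCorr]
    exact plusCorr_mono_params hβc (by rw [hβdef]; linarith) hh le_rfl {0}
  -- the finite-box bound, for every `L`
  have hbox : ∀ L : ℕ, magnetizationInField 3 β h ≤
      isingExpect (zdGraph 3) (box 3 L) β 0 .plus (spinAt 0) + β * X * h := by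
    intro L
    -- `m(β,h) ≤ ⟨σ₀⟩⁺_{box L; β, h}`
    have h2 : magnetizationInField 3 β h ≤ isingExpect (zdGraph 3) (box 3 L) β h .plus (spinAt 0) := by
      have hle := plusCorr_le_isingCorr_plus_box (d := 3) hβ hh
        (A := {0}) (L := L) (Finset.singleton_subset_iff.2 (zero_mem_box 3 L))
      rw [magnetizationInField_eq_plusCorr]
      refine hle.trans_eq ?_
      simp only [isingCorr]
      congr 1
      funext σ
      simp [spinProduct]
    -- GHS tangent line in the field
    have h3 := PerfectScreeningCoulombImpliesNontrivial.boxMag_le_zeroField_add_field_mul (d := 3) hβ hh L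
    -- the box-truncated functions at `h = 0` are bounded by the plus-state ones, whose partial sums are `≤ X`
    have h4 : ∑ y ∈ box 3 L,
        (isingExpect (zdGraph 3) (box 3 L) β 0 .plus (fun σ => spinAt 0 σ * spinAt y σ) -
          isingExpect (zdGraph 3) (box 3 L) β 0 .plus (spinAt 0) *
            isingExpect (zdGraph 3) (box 3 L) β 0 .plus (spinAt y)) ≤ X := by
      refine (Finset.sum_le_sum fun y hy => ?_).trans (hX (box 3 L))
      exact PerfectScreeningCoulombImpliesNontrivial.isingTrunc_plus_box_le_plusExpect (d := 3) hβ le_rfl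
        (zero_mem_box 3 L) hy
    have h5 : β * (∑ y ∈ box 3 L,
        (isingExpect (zdGraph 3) (box 3 L) β 0 .plus (fun σ => spinAt 0 σ * spinAt y σ) -
          isingExpect (zdGraph 3) (box 3 L) β 0 .plus (spinAt 0) *
            isingExpect (zdGraph 3) (box 3 L) β 0 .plus (spinAt y))) * h ≤ β * X * h := by
      have := mul_le_mul_of_nonneg_left h4 hβ
      exact mul_le_mul_of_nonneg_right this hh
    linarith
  -- `⟨σ₀⟩⁺_{box L; β, 0} → m*(β)`
  have hlim : Tendsto (fun L : ℕ => isingExpect (zdGraph 3) (box 3 L) β 0 .plus (spinAt 0) + β * X * h)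
      atTop (𝓝 (spontaneousMagnetization 3 β + β * X * h)) := by
    have h6 := tendsto_isingExpect_plus_spinFun (d := 3) hβ le_rfl {0} (fun s => s 0)
      (fun s t hst => hst 0 (by simp))
    exact h6.add_const _
  exact h1.trans (ge_of_tendsto hlim (Filter.Eventually.of_forall hbox))

/-- **Isotherm rate from two thermal rates.** If `m*(β_c + t) ≤ C₁ t^{b̂}` and all finite partial sums of the
plus-state truncated two-point function at `(β_c + t, 0)` are `≤ C₂ t^{-γ'}`, for `t ∈ (0, t₀]`, with `b̂ > 0`,
`γ' ≥ 0`, then `m(β_c, h) ≤ A h^{b̂/(b̂+γ')}` for `h ∈ (0, h₀]` (`t = h^{1/(b̂+γ')}`, `h₀ = min 1 t₀^{b̂+γ'}`,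
`A = C₁ + (β_c + t₀) C₂`). Under Widom scaling `b̂/(b̂+γ') = 1/δ`. -/
theorem isotherm_of_thermalRates {bh g C₁ C₂ t₀ : ℝ} (ht₀ : 0 < t₀) (hbh : 0 < bh) (hg : 0 ≤ g)
    (hM : ∀ t : ℝ, 0 < t → t ≤ t₀ → spontaneousMagnetization 3 (criticalBeta 3 + t) ≤ C₁ * t ^ bh)
    (hχ : ∀ t : ℝ, 0 < t → t ≤ t₀ → ∀ Λ : Finset (Site 3), ∑ y ∈ Λ,
      (plusExpect 3 (criticalBeta 3 + t) 0 (fun σ => spinAt 0 σ * spinAt y σ) -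
        plusExpect 3 (criticalBeta 3 + t) 0 (spinAt 0) * plusExpect 3 (criticalBeta 3 + t) 0 (spinAt y)) ≤
        C₂ * t ^ (-g)) :
    ∃ A h₀ : ℝ, 0 < h₀ ∧ ∀ h : ℝ, 0 < h → h ≤ h₀ →
      magnetizationInField 3 (criticalBeta 3) h ≤ A * h ^ (bh / (bh + g)) := by
  have hβc : 0 ≤ criticalBeta 3 := criticalBeta_nonneg 3
  have hs : 0 < bh + g := by linarith
  have hsne : bh + g ≠ 0 := hs.ne'
  -- `C₂ ≥ 0` is forced (the truncated sums over `Λ = ∅` vanish), `C₁` is replaced by `max C₁ 0`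
  have hC₂ : 0 ≤ C₂ := by
    have := hχ t₀ ht₀ le_rfl ∅
    rw [Finset.sum_empty] at this
    have hpos : 0 < t₀ ^ (-g) := Real.rpow_pos_of_pos ht₀ _
    nlinarith
  set C₁' : ℝ := max C₁ 0 with hC₁'
  have hC₁'0 : 0 ≤ C₁' := le_max_right _ _
  set h₀ : ℝ := min 1 (t₀ ^ (bh + g)) with hh₀def
  have hh₀ : 0 < h₀ := lt_min one_pos (Real.rpow_pos_of_pos ht₀ _)
  refine ⟨C₁' + (criticalBeta 3 + t₀) * C₂, h₀, hh₀, fun h hh hhh₀ => ?_⟩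
  have hh1 : h ≤ 1 := hhh₀.trans (min_le_left _ _)
  -- the temperature offset `t = h^{1/(b̂+γ')} ∈ (0, t₀]`
  set t : ℝ := h ^ (1 / (bh + g)) with htdef
  have ht0 : 0 < t := Real.rpow_pos_of_pos hh _
  have htt₀ : t ≤ t₀ := by
    have h1 : h ≤ t₀ ^ (bh + g) := hhh₀.trans (min_le_right _ _)
    have h2 : h ^ (1 / (bh + g)) ≤ (t₀ ^ (bh + g)) ^ (1 / (bh + g)) :=
      Real.rpow_le_rpow hh.le h1 (by positivity)
    have h3 : (t₀ ^ (bh + g)) ^ (1 / (bh + g)) = t₀ := by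
      rw [← Real.rpow_mul ht₀.le, mul_one_div_cancel hsne, Real.rpow_one]
    rw [htdef]
    exact h2.trans h3.le
  have ht1 : t ≤ 1 := by
    rw [htdef]
    exact Real.rpow_le_one hh.le hh1 (by positivity)
  -- the thermal bound at `t`
  have hmain := magnetizationInField_criticalBeta_le_thermal ht0.le hh.le (hχ t ht0 htt₀)
  -- exponent bookkeeping
  have hpow1 : t ^ bh = h ^ (bh / (bh + g)) := by
    rw [htdef, ← Real.rpow_mul hh.le]
    congr 1
    field_simp
  have hpow2 : t ^ (-g) * h = h ^ (bh / (bh + g)) := by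
    rw [htdef, ← Real.rpow_mul hh.le]
    conv_lhs => rw [show (h : ℝ) = h ^ (1:ℝ) from (Real.rpow_one h).symm]
    rw [← Real.rpow_mul hh.le, ← Real.rpow_add hh]
    congr 1
    field_simp
    ring
  have hu0 : 0 ≤ h ^ (bh / (bh + g)) := Real.rpow_nonneg hh.le _
  have hM' : spontaneousMagnetization 3 (criticalBeta 3 + t) ≤ C₁' * h ^ (bh / (bh + g)) := by
    calc spontaneousMagnetization 3 (criticalBeta 3 + t) ≤ C₁ * t ^ bh := hM t ht0 htt₀
      _ ≤ C₁' * t ^ bh := mul_le_mul_of_nonneg_right (le_max_left _ _) (Real.rpow_nonneg ht0.le _)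
      _ = C₁' * h ^ (bh / (bh + g)) := by rw [hpow1]
  have hX' : (criticalBeta 3 + t) * (C₂ * t ^ (-g)) * h ≤
      (criticalBeta 3 + t₀) * C₂ * h ^ (bh / (bh + g)) := by
    have h1 : (criticalBeta 3 + t) * (C₂ * t ^ (-g)) * h = (criticalBeta 3 + t) * C₂ * (t ^ (-g) * h) := by
      ring
    rw [h1, hpow2]
    have h2 : (criticalBeta 3 + t) * C₂ ≤ (criticalBeta 3 + t₀) * C₂ :=
      mul_le_mul_of_nonneg_right (by linarith) hC₂
    exact mul_le_mul_of_nonneg_right h2 hu0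
  calc magnetizationInField 3 (criticalBeta 3) h
      ≤ spontaneousMagnetization 3 (criticalBeta 3 + t) + (criticalBeta 3 + t) * (C₂ * t ^ (-g)) * h := hmain
    _ ≤ C₁' * h ^ (bh / (bh + g)) + (criticalBeta 3 + t₀) * C₂ * h ^ (bh / (bh + g)) := add_le_add hM' hX'
    _ = (C₁' + (criticalBeta 3 + t₀) * C₂) * h ^ (bh / (bh + g)) := by ring

/-- **The crux `EtaPositive` from two thermal rates** (registered stub; third pre-paid certificate of line `birth`):
if for `t ∈ (0, t₀]` the spontaneous magnetisation of the nearest-neighbour Ising model on `ℤ³` obeys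
`m*(β_c + t) ≤ C₁ t^{b̂}` and the finite partial sums of the plus-state truncated two-point function at `(β_c+t, 0)`
obey `Σ_{y∈Λ} ⟨σ₀;σ_y⟩⁺_{β_c+t,0} ≤ C₂ t^{-γ'}` (an upper bound on the plus-state susceptibility `χ⁺`), with
`b̂ > 0`, `γ' ≥ 0` and `4 b̂ > γ'`, then `EtaPositive` holds: the isotherm exponent `b = b̂/(b̂+γ')` exceeds `1/5`
iff `4b̂ > γ'`, and `EtaPositive_of_isothermGain` applies (`κ = (5b-1)/(b+1)`). Conjecturally `b̂ = 0.3265`,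
`γ' = 1.2372`, `4b̂ - γ' = 0.069`. -/
theorem EtaPositive_of_thermalRates :
    (∃ bh g C₁ C₂ t₀ : ℝ, 0 < t₀ ∧ 0 < bh ∧ 0 ≤ g ∧ g < 4 * bh ∧
      (∀ t : ℝ, 0 < t → t ≤ t₀ → spontaneousMagnetization 3 (criticalBeta 3 + t) ≤ C₁ * t ^ bh) ∧
      (∀ t : ℝ, 0 < t → t ≤ t₀ → ∀ Λ : Finset (Site 3), ∑ y ∈ Λ,
        (plusExpect 3 (criticalBeta 3 + t) 0 (fun σ => spinAt 0 σ * spinAt y σ) -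
          plusExpect 3 (criticalBeta 3 + t) 0 (spinAt 0) * plusExpect 3 (criticalBeta 3 + t) 0 (spinAt y)) ≤
          C₂ * t ^ (-g))) →
    Summit.CriticalPhenomena.Ising3DConformalLimit.Theses.AnomalousForcesInteraction.EtaPositive := by
  rintro ⟨bh, g, C₁, C₂, t₀, ht₀, hbh, hg, hg4, hM, hχ⟩
  obtain ⟨A, h₀, hh₀, H⟩ := isotherm_of_thermalRates ht₀ hbh hg hM hχ
  refine EtaPositive_of_isothermGain ⟨bh / (bh + g), A, h₀, ?_, hh₀, H⟩
  rw [div_lt_div_iff₀ (by norm_num) (by linarith)]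
  linarith

end Summit.CriticalPhenomena.Ising3DConformalLimit.AnomalousForcesInteractionEtaPositive

end
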